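import Mathlib
import Literature.NumberTheory.Transcendental.KZHomotopyMoves
import Literature.NumberTheory.Transcendental.KZLogCalculusProofs
import Literature.NumberTheory.Transcendental.KZDominatedFamilyRelations
import Literature.NumberTheory.Transcendental.KZMonomialCompression
import Literature.NumberTheory.Transcendental.KZSemialgebraicComplex
import Literature.NumberTheory.Transcendental.KZIntervalPeriodProofs
import Literature.NumberTheory.Transcendental.SemialgebraicMapsProofs

/-!
# Route `ComplexOrientations`, support item `CauchyMove` (stmt-KontsevichZagierPeriods-11370):
# the Cauchy move, part D3 — the rational parametrisation of the circle; rule (2) on `ℝ¹`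

Helper file (prover-owned, `--supports CauchyMove`). Elementary real algebra of
`γ(s) = ρ (1 + is)/(1 − is) = u(s) + i v(s)`, `u = ρ(1 − s²)/(1 + s²)`, `v = 2ρs/(1 + s²)`, and of
`γ'(s) = 2iρ/(1 − is)²`: real and imaginary parts, `‖γ'‖ = 2|ρ|/(1 + s²)`, derivatives
(`hasDerivAt_gamma_re/im`), `u² + v² = ρ²`, bounds, injectivity of `u` up to sign and of `v` up to
inversion, and the explicit algebraic inverses of `u` on `{s ≥ 0}` and of `v` on `{s² ≤ 1}`,
`{s² ≥ 1}` (`u_inv`, `v_inv1`, `v_inv2`) used to identify images without the intermediate value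
theorem. Finally `cov1`: the change-of-variables move of the Kontsevich–Zagier calculus
(`KZ.changeOfVariablesRel`) in dimension one, packaged for a scalar substitution `φ` with
`|det| = |φ'|`.

Sources: Kontsevich–Zagier, *Periods* (2001), §1.2 rule (2). Fully proved ([folklore]).
-/

noncomputable section

open MvPolynomial Set Metric MeasureTheory
open Literature.ModelTheory.ExponentialFields Literature.NumberTheory.Transcendental
open Literature.NumberTheory.Transcendental.KZ

namespace Summit.KontsevichZagierPeriods.ComplexOrientations.CauchyMoveAux

variable {ρ : ℝ}

/-! ### The rational parametrisation of the circle: real algebra -/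

section Circle

/-- `1 - s i ≠ 0` for real `s`. -/
theorem one_sub_mul_I_ne_zero (s : ℝ) : (1 : ℂ) - (s : ℂ) * Complex.I ≠ 0 := by
  intro h
  have := congr_arg Complex.re h
  simp at this

/-- `normSq (1 - s i) = 1 + s²`. -/
theorem normSq_one_sub_mul_I (s : ℝ) : Complex.normSq ((1 : ℂ) - (s : ℂ) * Complex.I) = 1 + s ^ 2 := by
  rw [Complex.normSq_apply]; simp; ring

/-- Real part of `γ(s) = ρ (1 + i s)/(1 - i s)`. -/
theorem gamma_re (ρ s : ℝ) :
    ((ρ : ℂ) * (1 + (s : ℂ) * Complex.I) / (1 - (s : ℂ) * Complex.I)).re =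
      ρ * (1 - s ^ 2) / (1 + s ^ 2) := by
  have hd : (1 : ℝ) + s ^ 2 ≠ 0 := by positivity
  rw [Complex.div_re, normSq_one_sub_mul_I]
  simp
  field_simp
  ring

/-- Imaginary part of `γ(s)`. -/
theorem gamma_im (ρ s : ℝ) :
    ((ρ : ℂ) * (1 + (s : ℂ) * Complex.I) / (1 - (s : ℂ) * Complex.I)).im =
      2 * ρ * s / (1 + s ^ 2) := by
  have hd : (1 : ℝ) + s ^ 2 ≠ 0 := by positivity
  rw [Complex.div_im, normSq_one_sub_mul_I]
  simp
  field_simp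
  ring

/-- Real part of `γ'(s) = 2 i ρ/(1 - i s)²`. -/
theorem gamma'_re (ρ s : ℝ) :
    ((ρ : ℂ) * (2 * Complex.I) / (1 - (s : ℂ) * Complex.I) ^ 2).re =
      -4 * ρ * s / (1 + s ^ 2) ^ 2 := by
  have hd : (1 : ℝ) + s ^ 2 ≠ 0 := by positivity
  rw [Complex.div_re, map_pow, normSq_one_sub_mul_I]
  simp [pow_two]
  field_simp
  ring

/-- Imaginary part of `γ'(s)`. -/
theorem gamma'_im (ρ s : ℝ) :
    ((ρ : ℂ) * (2 * Complex.I) / (1 - (s : ℂ) * Complex.I) ^ 2).im =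
      2 * ρ * (1 - s ^ 2) / (1 + s ^ 2) ^ 2 := by
  have hd : (1 : ℝ) + s ^ 2 ≠ 0 := by positivity
  rw [Complex.div_im, map_pow, normSq_one_sub_mul_I]
  simp [pow_two]
  field_simp

/-- `‖γ'(s)‖ = 2|ρ|/(1 + s²)`. -/
theorem norm_gamma' (ρ s : ℝ) :
    ‖(ρ : ℂ) * (2 * Complex.I) / (1 - (s : ℂ) * Complex.I) ^ 2‖ = 2 * |ρ| / (1 + s ^ 2) := by
  rw [norm_div, norm_pow, norm_mul, Complex.norm_real, Real.norm_eq_abs]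
  have h2 : ‖(2 : ℂ) * Complex.I‖ = 2 := by simp
  rw [h2, ← Complex.normSq_eq_norm_sq, normSq_one_sub_mul_I]
  ring

/-- The derivative of `γ` at a real point. -/
theorem hasDerivAt_gamma (ρ s : ℝ) :
    HasDerivAt (fun ζ : ℂ => (ρ : ℂ) * (1 + ζ * Complex.I) / (1 - ζ * Complex.I))
      ((ρ : ℂ) * (2 * Complex.I) / (1 - (s : ℂ) * Complex.I) ^ 2) (s : ℂ) := by
  have hc : HasDerivAt (fun ζ : ℂ => (ρ : ℂ) * (1 + ζ * Complex.I)) ((ρ : ℂ) * Complex.I) (s : ℂ) := by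
    have := ((hasDerivAt_id (s : ℂ)).mul_const Complex.I).const_add (1 : ℂ)
    simpa using this.const_mul (ρ : ℂ)
  have hd : HasDerivAt (fun ζ : ℂ => (1 : ℂ) - ζ * Complex.I) (-Complex.I) (s : ℂ) := by
    simpa using ((hasDerivAt_id (s : ℂ)).mul_const Complex.I).const_sub (1 : ℂ)
  have key : (ρ : ℂ) * (2 * Complex.I) / (1 - (s : ℂ) * Complex.I) ^ 2 =
      ((ρ : ℂ) * Complex.I * ((1 : ℂ) - (s : ℂ) * Complex.I) -
        (ρ : ℂ) * (1 + (s : ℂ) * Complex.I) * -Complex.I) / ((1 : ℂ) - (s : ℂ) * Complex.I) ^ 2 := by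
    congr 1; ring
  rw [key]
  exact hc.div hd (one_sub_mul_I_ne_zero s)

/-- `u = Re γ` has derivative `Re γ'` (as functions of the real parameter). -/
theorem hasDerivAt_gamma_re (ρ s : ℝ) :
    HasDerivAt (fun s : ℝ => ((ρ : ℂ) * (1 + (s : ℂ) * Complex.I) / (1 - (s : ℂ) * Complex.I)).re)
      ((ρ : ℂ) * (2 * Complex.I) / (1 - (s : ℂ) * Complex.I) ^ 2).re s :=
  (hasDerivAt_gamma ρ s).real_of_complex

/-- `v = Im γ` has derivative `Im γ'`. -/
theorem hasDerivAt_gamma_im (ρ s : ℝ) :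
    HasDerivAt (fun s : ℝ => ((ρ : ℂ) * (1 + (s : ℂ) * Complex.I) / (1 - (s : ℂ) * Complex.I)).im)
      ((ρ : ℂ) * (2 * Complex.I) / (1 - (s : ℂ) * Complex.I) ^ 2).im s := by
  have h := ((hasDerivAt_gamma ρ s).const_mul (-Complex.I)).real_of_complex
  simp only [Complex.mul_re, Complex.neg_re, Complex.I_re, zero_mul,
    Complex.I_im, zero_sub, neg_mul, one_mul, neg_neg] at h
  exact h

variable (ρ)

/-- `u² + v² = ρ²` on the circle. -/
theorem u_sq_add_v_sq (s : ℝ) :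
    (ρ * (1 - s ^ 2) / (1 + s ^ 2)) ^ 2 + (2 * ρ * s / (1 + s ^ 2)) ^ 2 = ρ ^ 2 := by
  have hd : (1 : ℝ) + s ^ 2 ≠ 0 := by positivity
  field_simp
  ring

variable {ρ}

/-- `-ρ < u(s) ≤ ρ` for `ρ > 0`. -/
theorem u_bounds (hρ : 0 < ρ) (s : ℝ) :
    -ρ < ρ * (1 - s ^ 2) / (1 + s ^ 2) ∧ ρ * (1 - s ^ 2) / (1 + s ^ 2) ≤ ρ := by
  have hd : (0 : ℝ) < 1 + s ^ 2 := by positivity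
  constructor
  · rw [lt_div_iff₀ hd]; nlinarith [sq_nonneg s]
  · rw [div_le_iff₀ hd]; nlinarith [sq_nonneg s]

/-- `v(s)² ≤ ρ²`. -/
theorem v_sq_le (s : ℝ) : (2 * ρ * s / (1 + s ^ 2)) ^ 2 ≤ ρ ^ 2 := by
  nlinarith [u_sq_add_v_sq ρ s, sq_nonneg (ρ * (1 - s ^ 2) / (1 + s ^ 2))]

/-- Injectivity of `u` up to sign: `u s = u s' → s² = s'²`. -/
theorem sq_eq_of_u_eq {s s' : ℝ} (hρ : ρ ≠ 0)
    (h : ρ * (1 - s ^ 2) / (1 + s ^ 2) = ρ * (1 - s' ^ 2) / (1 + s' ^ 2)) : s ^ 2 = s' ^ 2 := by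
  have hd : (1 : ℝ) + s ^ 2 ≠ 0 := by positivity
  have hd' : (1 : ℝ) + s' ^ 2 ≠ 0 := by positivity
  field_simp at h
  linear_combination (-(1 : ℝ) / 2) * h

/-- Injectivity of `v` up to inversion: `v s = v s' → s = s' ∨ s * s' = 1`. -/
theorem eq_or_mul_eq_one_of_v_eq {s s' : ℝ} (hρ : ρ ≠ 0)
    (h : 2 * ρ * s / (1 + s ^ 2) = 2 * ρ * s' / (1 + s' ^ 2)) : s = s' ∨ s * s' = 1 := by
  have hd : (1 : ℝ) + s ^ 2 ≠ 0 := by positivity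
  have hd' : (1 : ℝ) + s' ^ 2 ≠ 0 := by positivity
  field_simp at h
  have h3 : (s - s') * (1 - s * s') = 0 := by linear_combination h
  rcases mul_eq_zero.1 h3 with h4 | h4
  · exact Or.inl (by linarith)
  · exact Or.inr (by linarith)

/-- Explicit inverse of `u` on `s ≥ 0`: for `-ρ < y ≤ ρ`, `s = √((ρ - y)/(ρ + y))`. -/
theorem u_inv (hρ : 0 < ρ) {y : ℝ} (hy1 : -ρ < y) (hy2 : y ≤ ρ) :
    ρ * (1 - (√((ρ - y) / (ρ + y))) ^ 2) / (1 + (√((ρ - y) / (ρ + y))) ^ 2) = y := by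
  have hpos : 0 < ρ + y := by linarith
  have hρ0 : ρ ≠ 0 := hρ.ne'
  have hnn : 0 ≤ (ρ - y) / (ρ + y) := div_nonneg (by linarith) hpos.le
  rw [Real.sq_sqrt hnn]
  have h1 : 1 - (ρ - y) / (ρ + y) = 2 * y / (ρ + y) := by field_simp; ring
  have h2 : 1 + (ρ - y) / (ρ + y) = 2 * ρ / (ρ + y) := by field_simp; ring
  rw [h1, h2, mul_div_assoc', div_div_div_cancel_right₀ hpos.ne']
  field_simp

end Circle


section Circle2

/-- Explicit inverse of `v` on `s² ≤ 1`: for `y² ≤ ρ²`, `s = y/(ρ + √(ρ² - y²))`. -/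
theorem v_inv1 (hρ : 0 < ρ) {y : ℝ} (hy : y ^ 2 ≤ ρ ^ 2) :
    (y / (ρ + √(ρ ^ 2 - y ^ 2))) ^ 2 ≤ 1 ∧
      2 * ρ * (y / (ρ + √(ρ ^ 2 - y ^ 2))) / (1 + (y / (ρ + √(ρ ^ 2 - y ^ 2))) ^ 2) = y := by
  set w := √(ρ ^ 2 - y ^ 2) with hw
  have hw0 : 0 ≤ w := Real.sqrt_nonneg _
  have hw2 : w ^ 2 = ρ ^ 2 - y ^ 2 := Real.sq_sqrt (by linarith)
  have hpos : 0 < ρ + w := by linarith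
  constructor
  · rw [div_pow, div_le_one (by positivity)]
    nlinarith
  · have h1 : 1 + (y / (ρ + w)) ^ 2 = 2 * ρ / (ρ + w) := by
      field_simp
      nlinarith [hw2]
    rw [h1]
    field_simp

/-- Explicit inverse of `v` on `1 ≤ s²`: for `0 ≠ y`, `y² ≤ ρ²`, `s = (ρ + √(ρ² - y²))/y`. -/
theorem v_inv2 (hρ : 0 < ρ) {y : ℝ} (hy : y ^ 2 ≤ ρ ^ 2) (hy0 : y ≠ 0) :
    1 ≤ ((ρ + √(ρ ^ 2 - y ^ 2)) / y) ^ 2 ∧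
      2 * ρ * ((ρ + √(ρ ^ 2 - y ^ 2)) / y) / (1 + ((ρ + √(ρ ^ 2 - y ^ 2)) / y) ^ 2) = y := by
  set w := √(ρ ^ 2 - y ^ 2) with hw
  have hw0 : 0 ≤ w := Real.sqrt_nonneg _
  have hw2 : w ^ 2 = ρ ^ 2 - y ^ 2 := Real.sq_sqrt (by linarith)
  have hpos : 0 < ρ + w := by linarith
  have hy2 : 0 < y ^ 2 := by positivity
  constructor
  · rw [div_pow, one_le_div hy2]
    nlinarith
  · have h1 : 1 + ((ρ + w) / y) ^ 2 = 2 * ρ * (ρ + w) / y ^ 2 := by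
      field_simp
      nlinarith [hw2]
    rw [h1]
    field_simp

/-- Branch selection: on a circle of radius `ρ`, a non-negative ordinate is `√(ρ² - abscissa²)`. -/
theorem eq_sqrt_of_sq_add_sq {a b : ℝ} (h : a ^ 2 + b ^ 2 = ρ ^ 2) (hb : 0 ≤ b) :
    b = √(ρ ^ 2 - a ^ 2) := by
  rw [show ρ ^ 2 - a ^ 2 = b ^ 2 by linarith, Real.sqrt_sq hb]

/-- Branch selection: a non-positive ordinate is `-√(ρ² - abscissa²)`. -/
theorem eq_neg_sqrt_of_sq_add_sq {a b : ℝ} (h : a ^ 2 + b ^ 2 = ρ ^ 2) (hb : b ≤ 0) :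
    b = -√(ρ ^ 2 - a ^ 2) := by
  rw [show ρ ^ 2 - a ^ 2 = (-b) ^ 2 by linarith, Real.sqrt_sq (by linarith)]
  ring

end Circle2

/-! ### Rule (2) in dimension one, packaged -/

/-- **A one-variable substitution is a change-of-variables move.** If `φ` is `ℚ`-semialgebraic on
`r.domain ⊆ ℝ¹`, differentiable there with derivative `φ'`, injective on it, `r'.domain` is its
image and `f = (f' ∘ φ) · |φ'|` on `r.domain`, then `[r] − [r'] ∈ KZ.relations` (rule (2) with
`Φ = φ`, `Φ' = φ' • id`, `|det Φ'| = |φ'|`). -/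
theorem cov1 (r r' : IntegralRep 1) (φ φ' : ℝ → ℝ)
    (hsa : IsSemialgebraicFunOn ℚ r.domain fun z => φ (z 0))
    (hder : ∀ z ∈ r.domain, HasDerivAt φ (φ' (z 0)) (z 0))
    (hinj : ∀ z ∈ r.domain, ∀ z' ∈ r.domain, φ (z 0) = φ (z' 0) → z 0 = z' 0)
    (hdom : r'.domain = (fun z : Fin 1 → ℝ => (fun _ : Fin 1 => φ (z 0))) '' r.domain)
    (hint : ∀ z ∈ r.domain, r.integrand z = r'.integrand (fun _ => φ (z 0)) * |φ' (z 0)|) :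
    of r - of r' ∈ relations := by
  set Φ : (Fin 1 → ℝ) → (Fin 1 → ℝ) := fun z _ => φ (z 0) with hΦ
  set Φ' : (Fin 1 → ℝ) → (Fin 1 → ℝ) →L[ℝ] (Fin 1 → ℝ) := fun z =>
    φ' (z 0) • ContinuousLinearMap.id ℝ (Fin 1 → ℝ) with hΦ'
  have hdet : ∀ z, (Φ' z).det = φ' (z 0) := fun z => by
    simp only [hΦ', ContinuousLinearMap.det, ContinuousLinearMap.toLinearMap_smul,
      ContinuousLinearMap.coe_id, LinearMap.det_smul, LinearMap.det_id, mul_one,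
      Module.finrank_fin_fun, pow_one]
  refine changeOfVariablesRel_subset_relations ⟨1, r, r', Φ, Φ', ?_, ?_, ?_, hdom, ?_, rfl⟩
  · exact IsSemialgebraicMapOn.of_forall r.isSemialgebraic_domain fun _ => hsa
  · intro z hz
    refine (hasFDerivAt_pi'.2 fun i => ?_).hasFDerivWithinAt
    have h := (hder z hz).comp_hasFDerivAt z
      ((ContinuousLinearMap.proj (R := ℝ) (φ := fun _ : Fin 1 => ℝ) 0).hasFDerivAt)
    have hfun : (fun x => Φ x i) = φ ∘ ⇑(ContinuousLinearMap.proj (R := ℝ)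
        (φ := fun _ : Fin 1 => ℝ) 0) := by
      funext x; simp [hΦ]
    have hlin : (ContinuousLinearMap.proj i).comp (Φ' z) =
        φ' (z 0) • ContinuousLinearMap.proj (R := ℝ) (φ := fun _ : Fin 1 => ℝ) 0 := by
      ext v
      rw [Subsingleton.elim i 0]
      simp [hΦ']
    rw [hfun, hlin]
    exact h
  · intro z hz z' hz' h
    have h0 : φ (z 0) = φ (z' 0) := congr_fun h 0
    funext i
    rw [Subsingleton.elim i 0]
    exact hinj z hz z' hz' h0
  · intro z hz
    rw [hint z hz, hdet]

end Summit.KontsevichZagierPeriods.ComplexOrientations.CauchyMoveAux
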